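import Literature.NumberTheory.GaloisRepresentations.HeckeCharacterAutConj
import HarnessLib

/-!
# Weil's conjugates compose: `^σ(^ρχ) = ^{σρ}χ`

Topic `NumberTheory/GaloisRepresentations`, namespace
`Literature.NumberTheory.GaloisRepresentations`; sequel of `HeckeCharacterAutConj` (Weil 1956, §1:
the conjugate `^σχ = HasInfinityType.autConj h σ` of a Hecke character `χ` of infinity type
`(p, q)`, of infinity type `^σ(p, q) = autConjType σ p q`).

**Weil 1956, §1** defines `^σχ` for EVERY `σ ∈ Aut(ℂ)`; that `σ ↦ ^σχ` is an ACTION —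
`^σ(^ρχ) = ^{σρ}χ` — is implicit there (and explicit in Clozel 1990, §1, `^{στ}π = ^σ(^τπ)` for
`n = 1`; Patrikis 2019, §2.4). On the tree's construction it is a two-line computation: on an idele
`x`, `^ρχ(x) = ρ(χ(x)·A_{p,q}(x_∞)⁻¹)·A_{^ρ(p,q)}(x_∞)`, so
`^σ(^ρχ)(x) = σ(ρ(χ(x)A_{p,q}(x_∞)⁻¹))·A_{^σ(^ρ(p,q))}(x_∞)`, and the conjugate types compose:
`^σ(^ρ(p, q)) = ^{σρ}(p, q)` (the exponent of `φ` is that of `ρ⁻¹σ⁻¹φ = (σρ)⁻¹φ`).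

## Main statements

* `HeckeCharacter.autConjType_autConjType` — `^σ(^ρ(p, q)) = ^{σρ}(p, q)` (private helper
  `symm_mul_comp_eq`: `(σρ)⁻¹ ∘ φ = ρ⁻¹ ∘ (σ⁻¹ ∘ φ)`).
* **`HeckeCharacter.HasInfinityType.autConj_autConj`** — `^σ(^ρχ) = ^{σρ}χ` (with the canonical
  infinity-type witness `h.hasInfinityType_autConj ρ` of `^ρχ`), and the proof-irrelevant form
  `HasInfinityType.autConj_autConj_of_eq` for ANY witness of ANY type `(p', q') = ^ρ(p, q)` of `^ρχ`
  (the form consumers need: `autConj` reads the type, not the witness).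
* `HeckeCharacter.HasInfinityType.autConj_eq_of_eq` — `autConj` depends on the TYPE only: two
  witnesses of types `(p, q) = (p', q')` give the same conjugate.

## References

* A. Weil, *On a certain type of characters of the idèle-class group of an algebraic
  number-field*, Proc. Int. Symp. Tokyo–Nikko 1955 (1956), 1–7, §1. [Weil1956]
* L. Clozel, *Motifs et formes automorphes*, in Automorphic forms, Shimura varieties, and
  L-functions I (1990), §1 and Thm. 3.13 (`n = 1`). [Clozel1990]
* S. Patrikis, *Variations on a theorem of Tate*, Mem. AMS 258 (2019), §2.4. [Patrikis2019]
-/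

noncomputable section

open scoped NumberField
open NumberField

namespace Literature.NumberTheory.GaloisRepresentations

universe u

variable {K : Type u} [Field K] [NumberField K]

namespace HeckeCharacter

omit [NumberField K] in
/-- `(σρ)⁻¹ ∘ φ = ρ⁻¹ ∘ (σ⁻¹ ∘ φ)` for an embedding `φ : K → ℂ`. [folklore] -/
private theorem symm_mul_comp_eq (σ ρ : ℂ ≃ₐ[ℚ] ℂ) (φ : K →+* ℂ) :
    ((σ * ρ).symm : ℂ ≃ₐ[ℚ] ℂ).toAlgHom.toRingHom.comp φ =
      (ρ.symm : ℂ ≃ₐ[ℚ] ℂ).toAlgHom.toRingHom.comp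
        ((σ.symm : ℂ ≃ₐ[ℚ] ℂ).toAlgHom.toRingHom.comp φ) := by
  ext k
  change (σ * ρ).symm (φ k) = ρ.symm (σ.symm (φ k))
  rw [AlgEquiv.symm_apply_eq]
  simp [AlgEquiv.mul_apply]

omit [NumberField K] in
/-- **The conjugate types compose: `^σ(^ρ(p, q)) = ^{σρ}(p, q)`** — the exponent of the embedding
`φ` in `^σ(^ρ(p, q))` is the exponent of `σ⁻¹ ∘ φ` in `^ρ(p, q)`, i.e. that of
`ρ⁻¹ ∘ σ⁻¹ ∘ φ = (σρ)⁻¹ ∘ φ` in `(p, q)` (Weil 1956, §1; Clozel 1990, §1). [cite: Weil1956, §1] -/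
theorem autConjType_autConjType (σ ρ : ℂ ≃ₐ[ℚ] ℂ) (p q : InfinitePlace K → ℤ) :
    autConjType σ (autConjType ρ p q).1 (autConjType ρ p q).2 = autConjType (σ * ρ) p q := by
  unfold autConjType
  congr 1
  funext φ
  rw [embExponent_typeOfExponent, symm_mul_comp_eq]

/-- **`autConj` depends only on the TYPE, not on the witness**: for witnesses `h : χ` has type
`(p, q)` and `h' : χ` has type `(p', q')` with `p = p'`, `q = q'`, `h.autConj σ = h'.autConj σ`
(proof irrelevance after transport: Weil's `^σχ` is attached to `χ` and its type `(p, q)`).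
[cite: Weil1956, §1] -/
theorem HasInfinityType.autConj_eq_of_eq {χ : HeckeCharacter K} {p q p' q' : InfinitePlace K → ℤ}
    (h : χ.HasInfinityType p q) (h' : χ.HasInfinityType p' q') (hp : p = p') (hq : q = q')
    (σ : ℂ ≃ₐ[ℚ] ℂ) : h.autConj σ = h'.autConj σ := by
  subst hp hq
  rfl

/-- **Weil's conjugates compose: `^σ(^ρχ) = ^{σρ}χ`** (canonical witness of the type of `^ρχ`).
On an idele `x`: `^σ(^ρχ)(x) = σ(ρ(χ(x)A_{p,q}(x_∞)⁻¹)·A'(x_∞)·A'(x_∞)⁻¹)·A_{^σ^ρ(p,q)}(x_∞)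
= (σρ)(χ(x)A_{p,q}(x_∞)⁻¹)·A_{^{σρ}(p,q)}(x_∞) = ^{σρ}χ(x)` by `autConjType_autConjType`
(Weil 1956, §1; Clozel 1990, §1 `^{στ}π = ^σ(^τπ)`). [cite: Weil1956, §1] -/
theorem HasInfinityType.autConj_autConj {χ : HeckeCharacter K} {p q : InfinitePlace K → ℤ}
    (h : χ.HasInfinityType p q) (σ ρ : ℂ ≃ₐ[ℚ] ℂ) :
    (h.hasInfinityType_autConj ρ).autConj σ = h.autConj (σ * ρ) := by
  refine HeckeCharacter.ext fun x ↦ Units.ext ?_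
  rw [HasInfinityType.autConj_apply, HasInfinityType.autConj_apply, HasInfinityType.autConj_apply,
    mul_inv_cancel_right₀ (archFactor_ne_zero _ _ _), autConjType_autConjType, AlgEquiv.mul_apply]

/-- **`^σ(^ρχ) = ^{σρ}χ` for ANY witness `h'` that `^ρχ` has a type `(p', q')` equal to
`^ρ(p, q)`** — the form a consumer holding its own witness (e.g. of the SAME type `(p, q)` when
`ρ` fixes the embeddings of a field without real places) needs. [cite: Weil1956, §1] -/
theorem HasInfinityType.autConj_autConj_of_eq {χ : HeckeCharacter K} {p q p' q' : InfinitePlace K → ℤ}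
    (h : χ.HasInfinityType p q) (ρ : ℂ ≃ₐ[ℚ] ℂ) (h' : (h.autConj ρ).HasInfinityType p' q')
    (hp : p' = (autConjType ρ p q).1) (hq : q' = (autConjType ρ p q).2) (σ : ℂ ≃ₐ[ℚ] ℂ) :
    h'.autConj σ = h.autConj (σ * ρ) := by
  rw [h'.autConj_eq_of_eq (h.hasInfinityType_autConj ρ) hp hq σ, h.autConj_autConj σ ρ]

end HeckeCharacter

end Literature.NumberTheory.GaloisRepresentations
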